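import Summits.QuantumFields.BalabanUV.T4Continuum.Support.GradedWellTorusTransfer
import Summits.QuantumFields.BalabanUV.T4Continuum.Support.TowerRebase
import Summits.QuantumFields.BalabanUV.T4Continuum.Support.PerturbationAlgebra

/-!
# T⁴ programme, spine node NE2 (U1a), sub-row Δ1 — THE GRADED WELL: (GW-A) THE TOWER ASSEMBLY from the torus transfer, and
# (GW-Bᵗ) ⟸ (GW-B) FOR FREE (King's torus planting is an isometry — no deficient-layer trace term)

NE2 formalisation swarm `b2b-balaban-t4-ne2-formalise-*`, LEAF PROVER 06 (gen 8), sockets (GW-A) and (GW-Bᵗ) of the owner's graded well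
(rulings R47 (e) / R48 (c) / R49, journal 2026-08-21 l.25022 / l.25393 / l.25770; spec `t4/T4-EST-NE2-D1-GW-SPEC.md` v1), on the owner's
O16-f `GradedWellTorusTransfer` (p245843): there `hinjK_GW_of_torus` gives King's injected law of the graded-well propagators
`G_GW(k) = (regionGW_k)⁻¹` for every `k ≥ m` from the FAITHFUL UNIT TORUS LAW (a theorem) modulo coercivity `γ` of `regionGW`
((GW-W1)+(GW-S0)), the level-free norm `‖E_k‖ ≤ e` of `E_k = Δ_a^{(k)} − regionGW_k` and ONE two-level leaf (GW-E).

 * §1 **(GW-Bᵗ) ⟸ (GW-B), Cbt = Cb.**  In the box star tower (`RegionGaugeColumnsTrace`, p239685) the adjoint half (Bᵗ) of the resolvent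
   split needed a deficient-layer TRACE of the gauge columns because the region planting satisfies `JᴴJ = 1 − (1−L⁻¹)•P_def`.  On the
   torus King's planting is an ISOMETRY (`KingPairingPlantedLaw.JK_conjTranspose_mul_JK : JᴴJ = 1`): `JᴴB′ − B = Jᴴ(B′ − JB)`, so
   **`opNorm_adjoint_defect_le_of_isometry`** `‖JᴴB′ − B‖ ≤ ‖B′ − JB‖` (generic), **`opNorm_adjoint_defect_le_king`** (the instance at
   `J = JpcT L M k`), and the (E2)-shape **`opNorm_sandwich_comm_le_of_isometry`** = `RegionGaugeResolventSplit.opNorm_sandwich_comm_le`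
   with the `hBt` hypothesis REMOVED: `‖B′Kᵢ′B′ᴴJ − J·BKᵢBᴴ‖ ≤ b′·ki·εB + (εB·ki + b·εK)·b`.  Hence (E2) ⟸ (GW-B) ∧ (GW-K) only; the
   named instance on the owner's `BhGW`/`BhGWL`/`KGW`/`KGWL` (file 4 `GradedWellTwoLevel`, staged) is a one-line corollary.
 * §2 **the complement law of the graded well costs nothing**: `X⁻¹ = (1 + X⁻¹E)·Y⁻¹` (`RegionGaugeResolventSplit.one_add_mul_inv_eq`)
   turns the torus complement law `KingPairingPlantedLaw.complement_le_lev` into **`complement_le_GW`**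
   `‖G_GW(k+1)·(1 − J_kJ_kᴴ)‖ ≤ (1 + γ⁻¹e)·2d·Cst·L^{−k}`.
 * §3 **`freeTowerLaws_GW_of_torus`**: the `U = 1` bundle `BackgroundResolventTower.FreeTowerLaws` for the graded-well tower RE-BASED
   at level `m` (levels `k ≥ m`, so that every layer scale `L^{k−i}` is a positive power — `TowerRebase`, row L2): King's averagings
   `Qlev (m+k)`, plantings `JpcT (m+k)`, pairing defect `0`, complement law §2, injected law = `hinjK_GW_of_torus` — from EXACTLY the
   hypotheses of `hinjK_GW_of_torus`.
 * §4 **(GW-A) `towerLimitRate_GW_of_torus`**: for `L⁻¹ ≤ θ < 1` the King-averaged images of the graded-well propagators on the level-`m`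
   lattice CONVERGE, `TowerLimitRate (k ↦ Qlev (m+k)) L^d (k ↦ G_GW(m+k)) (Cpert 0 C₀ C₁ 0 0 0) θ` with
   `C₀ = (1 + γ⁻¹e)·2d·Cst·θ^m`, `C₁ = C1T d a γ e Ce·θ^m` (King's scale-covariant factor `θ^m`) — MODULO EXACTLY `hco` ((GW-W1)+(GW-S0)),
   `hE` (`‖E‖ ≤ e`) and `hEc` ((GW-E)); **`towerLimitRate_GW_perturbed`**: the same for `(regionGW + tP)⁻¹` under any
   `PerturbationLaws` family on the re-based tower and `‖t‖κ < 1` — how tiers A/B re-run on the graded well.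

HONEST FRAMING (T4-DAG p. 1).  [folklore] bookkeeping over landed modules (model level: `U = 1`, one layer map on unit blocks, `m` fixed,
finite torus, operator norm); `γ`, `e`, (GW-E) DISPLAYED — nothing of them is discharged here; NOT a statement about Bałaban's
multi-region kernels; NE2 (U1a) NOT proved; spine PROVED 0/9 unchanged; NOT [B9] (3.16)/(3.23)–(3.27)/(3.42) as printed; NOT infinite
volume / mass gap / Clay.  HONEST DEPENDENCY: continuum YM on T⁴ ⇐ BetaPertH ∧ nine spine estimates (0/9 proved); BetaPertH ⇐ (D1) ∧ (D4) ∧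
CAP+tail; G-an2-4 gates asym, D1 and NE2/3/4.  No `sorry`.
-/

noncomputable section

open scoped BigOperators ComplexConjugate Matrix Matrix.Norms.L2Operator

namespace Summit.QuantumFields.BalabanUV.T4Continuum.GradedWellTowerAssembly

open Literature.MathematicalPhysics.QuantumFieldTheory.Balaban1983to89.B5Prop11Plancherel (Tor fine Cst Cst_nonneg)
open Literature.MathematicalPhysics.QuantumFieldTheory.Balaban1983to89.B5G183RateUnitTower (lev lev_neZero)
open Summit.QuantumFields.BalabanUV.T4Continuum
open Summit.QuantumFields.BalabanUV.T4Continuum.CovariantAveragingTower (TowerLimitRate)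
open Summit.QuantumFields.BalabanUV.T4Continuum.BackgroundResolventTower
open Summit.QuantumFields.BalabanUV.T4Continuum.BalabanAveragedTowerUnit (idx Qlev opNorm_Qlev_sq_le)
open Summit.QuantumFields.BalabanUV.T4Continuum.SubtypeCompression (Coercive isUnit_det_of_coercive opNorm_inv_le_of_coercive)
open Summit.QuantumFields.BalabanUV.T4Continuum.KingPairingPlantedLaw (JK JpcT calDalev CJ CJ_nonneg opNorm_JpcT_le complement_le_lev
  sqrt_smul_Qlev_mul_JpcT JpcT_conjTranspose_mul_JpcT)
open Summit.QuantumFields.BalabanUV.T4Continuum.DirichletRegionTower (gamD gamD_pos coercive_calDalev)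
open Summit.QuantumFields.BalabanUV.T4Continuum.RegionGaugeResolventSplit (one_add_mul_inv_eq opNorm_one_add_le opNorm_sandwich_comm_le)
open Summit.QuantumFields.BalabanUV.T4Continuum.PerturbationAlgebra (perturbationLaws_zero)
open Summit.QuantumFields.BalabanUV.T4Continuum.TowerRebase (towerLimitRate_rebase)
open Summit.QuantumFields.BalabanUV.T4Continuum.GradedWellData
open Summit.QuantumFields.BalabanUV.T4Continuum.GradedWellTorusTransfer (EGW regionGW_eq_calDalev_sub C1T hinjK_GW_of_torus)

/-! ## §1 (GW-Bᵗ) ⟸ (GW-B): the adjoint defect of an isometric planting, and the sandwich commutator without `hBt` -/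

section Isometry

variable {v v' u : Type*} [Fintype v] [DecidableEq v] [Fintype v'] [DecidableEq v'] [Fintype u] [DecidableEq u]

/-- **(Bᵗ) ⟸ (B) FOR AN ISOMETRIC PLANTING**: `JᴴJ = 1`, `‖J‖ ≤ 1` ⟹ `‖JᴴB′ − B‖ ≤ ‖B′ − JB‖` (no deficient-layer trace term).
[folklore] -/
theorem opNorm_adjoint_defect_le_of_isometry (J : Matrix v' v ℂ) (hJ : Jᴴ * J = 1) (hJ1 : ‖J‖ ≤ 1) (B : Matrix v u ℂ)
    (B' : Matrix v' u ℂ) : ‖Jᴴ * B' - B‖ ≤ ‖B' - J * B‖ := by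
  have e : Jᴴ * B' - B = Jᴴ * (B' - J * B) := by
    rw [Matrix.mul_sub, ← Matrix.mul_assoc, hJ, Matrix.one_mul]
  have hJt : ‖Jᴴ‖ ≤ 1 := by rw [Matrix.l2_opNorm_conjTranspose]; exact hJ1
  rw [e]
  calc ‖Jᴴ * (B' - J * B)‖ ≤ ‖Jᴴ‖ * ‖B' - J * B‖ := Matrix.l2_opNorm_mul _ _
    _ ≤ 1 * ‖B' - J * B‖ := mul_le_mul_of_nonneg_right hJt (norm_nonneg _)
    _ = ‖B' - J * B‖ := one_mul _

/-- **THE SANDWICH COMMUTATOR FOR AN ISOMETRIC PLANTING** (`RegionGaugeResolventSplit.opNorm_sandwich_comm_le` with `hBt` discharged by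
`opNorm_adjoint_defect_le_of_isometry` and `j = 1`): for `E = B·Kᵢ·Bᴴ`, `E′ = B′·Kᵢ′·B′ᴴ`,
`‖E′J − JE‖ ≤ b′·ki·εB + (εB·ki + b·εK)·b` — (E2) ⟸ (B) ∧ (K) only. [folklore] -/
theorem opNorm_sandwich_comm_le_of_isometry (B : Matrix v u ℂ) (B' : Matrix v' u ℂ) (Ki Ki' : Matrix u u ℂ) (J : Matrix v' v ℂ)
    (hJ : Jᴴ * J = 1) (hJ1 : ‖J‖ ≤ 1) {b b' ki εB εK : ℝ} (hb : ‖B‖ ≤ b) (hb' : ‖B'‖ ≤ b') (hki : ‖Ki'‖ ≤ ki)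
    (hB : ‖B' - J * B‖ ≤ εB) (hK : ‖Ki' - Ki‖ ≤ εK) (hb0 : 0 ≤ b) (hb0' : 0 ≤ b') (hki0 : 0 ≤ ki) (hεB : 0 ≤ εB) :
    ‖B' * Ki' * B'ᴴ * J - J * (B * Ki * Bᴴ)‖ ≤ b' * ki * εB + (εB * ki + b * εK) * b := by
  have hBt : ‖Jᴴ * B' - B‖ ≤ εB := (opNorm_adjoint_defect_le_of_isometry J hJ hJ1 B B').trans hB
  have h := opNorm_sandwich_comm_le B B' Ki Ki' J hb hb' hki hJ1 hB hBt hK hb0 hb0' hki0 zero_le_one hεB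
  rw [one_mul] at h
  exact h

end Isometry

section King

variable {d : ℕ} (L : ℕ) [NeZero L] (M : Fin d → ℕ) [hM : ∀ μ, NeZero (M μ)]

/-- **(GW-Bᵗ) ⟸ (GW-B) ON THE TORUS, Cbt = Cb**: for King's planting `J_k = JpcT L M k` (an isometry, `J_kᴴJ_k = 1`) and ANY pair of
column families `B` (level `k`), `B′` (level `k+1`) with a common row index, `‖J_kᴴB′ − B‖ ≤ ‖B′ − J_kB‖` — the owner's socket
(GW-Bᵗ) `‖(JGW k)ᴴ·BhGWL k hk − BhGW k‖ ≤ Cbt·L^{−k}` follows from (GW-B) with the same constant. [folklore] -/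
theorem opNorm_adjoint_defect_le_king {u : Type*} [Fintype u] [DecidableEq u] (k : ℕ) (B : Matrix (idx L M k) u ℂ)
    (B' : Matrix (idx L M (k + 1)) u ℂ) : ‖(JpcT L M k)ᴴ * B' - B‖ ≤ ‖B' - JpcT L M k * B‖ :=
  opNorm_adjoint_defect_le_of_isometry (JpcT L M k) (JpcT_conjTranspose_mul_JpcT L M k) (opNorm_JpcT_le L M k) B B'

/-- the same along a tower of column families with a geometric (GW-B) majorant: (GW-Bᵗ) with the SAME majorant. [folklore] -/
theorem adjoint_defect_tower_of_king {u : Type*} [Fintype u] [DecidableEq u] {m : ℕ} {Cb θ : ℝ}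
    (B : (k : ℕ) → Matrix (idx L M k) u ℂ) (B' : (k : ℕ) → Matrix (idx L M (k + 1)) u ℂ)
    (hB : ∀ k, m ≤ k → ‖B' k - JpcT L M k * B k‖ ≤ Cb * θ ^ k) (k : ℕ) (hk : m ≤ k) :
    ‖(JpcT L M k)ᴴ * B' k - B k‖ ≤ Cb * θ ^ k :=
  (opNorm_adjoint_defect_le_king L M k (B k) (B' k)).trans (hB k hk)

/-- **(E2)-shape on the torus**: the two-level law of a gauge sandwich `B_k·Kᵢ_k·B_kᴴ` under King's planting needs only the column law
(B) `‖B′ − J_kB‖ ≤ εB` and the Gram law (K) `‖Kᵢ′ − Kᵢ‖ ≤ εK`. [folklore] -/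
theorem opNorm_sandwich_comm_le_king {u : Type*} [Fintype u] [DecidableEq u] (k : ℕ) (B : Matrix (idx L M k) u ℂ)
    (B' : Matrix (idx L M (k + 1)) u ℂ) (Ki Ki' : Matrix u u ℂ) {b b' ki εB εK : ℝ} (hb : ‖B‖ ≤ b) (hb' : ‖B'‖ ≤ b')
    (hki : ‖Ki'‖ ≤ ki) (hB : ‖B' - JpcT L M k * B‖ ≤ εB) (hK : ‖Ki' - Ki‖ ≤ εK) (hb0 : 0 ≤ b) (hb0' : 0 ≤ b') (hki0 : 0 ≤ ki)
    (hεB : 0 ≤ εB) :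
    ‖B' * Ki' * B'ᴴ * JpcT L M k - JpcT L M k * (B * Ki * Bᴴ)‖ ≤ b' * ki * εB + (εB * ki + b * εK) * b :=
  opNorm_sandwich_comm_le_of_isometry B B' Ki Ki' (JpcT L M k) (JpcT_conjTranspose_mul_JpcT L M k) (opNorm_JpcT_le L M k) hb hb'
    hki hB hK hb0 hb0' hki0 hεB

end King

/-! ## §2 One level: the complement law of the graded well from the torus complement law -/

section OneLevel

variable {d : ℕ} (L : ℕ) [NeZero L] (M : Fin d → ℕ) [hM : ∀ μ, NeZero (M μ)] (k m : ℕ) (layer : Tor M → ℕ) (a a' : ℝ) (ha : 0 < a)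

/-- `‖G_GW‖ ≤ γ⁻¹` from coercivity (bookkeeping). [folklore] -/
theorem opNorm_inv_regionGW_le {γ : ℝ} (hγ : 0 < γ) (hco : Coercive (regionGW L M k m layer a a') γ) :
    ‖(regionGW L M k m layer a a')⁻¹‖ ≤ γ⁻¹ := opNorm_inv_le_of_coercive hγ hco

/-- `‖G_GW·E‖ ≤ γ⁻¹·e`. [folklore] -/
theorem opNorm_inv_mul_EGW_le {γ e : ℝ} (hγ : 0 < γ) (hco : Coercive (regionGW L M k m layer a a') γ)
    (hE : ‖EGW L M k m layer a a' ha‖ ≤ e) : ‖(regionGW L M k m layer a a')⁻¹ * EGW L M k m layer a a' ha‖ ≤ γ⁻¹ * e :=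
  (Matrix.l2_opNorm_mul _ _).trans (mul_le_mul (opNorm_inv_le_of_coercive hγ hco) hE (norm_nonneg _) (inv_nonneg.mpr hγ.le))

/-- **THE COMPLEMENT LAW OF THE GRADED WELL** (`regionGW_{k+1}` `γ`-coercive, `‖E_{k+1}‖ ≤ e`): since
`G_GW = (1 + G_GW·E)·(Δ_a)⁻¹`, the torus complement law gives `‖G_GW(k+1)·(1 − J_kJ_kᴴ)‖ ≤ (1 + γ⁻¹e)·2d·Cst·L^{−k}`. [folklore] -/
theorem complement_le_GW {γ e : ℝ} (hγ : 0 < γ) (he : 0 ≤ e) (hco' : Coercive (regionGW L M (k + 1) m layer a a') γ)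
    (hE' : ‖EGW L M (k + 1) m layer a a' ha‖ ≤ e) :
    ‖(regionGW L M (k + 1) m layer a a')⁻¹ * (1 - JpcT L M k * (JpcT L M k)ᴴ)‖
      ≤ (1 + γ⁻¹ * e) * (2 * d * Cst d a * ((L : ℝ)⁻¹) ^ k) := by
  have hX' := isUnit_det_of_coercive hγ hco'
  have hY' := isUnit_det_of_coercive (gamD_pos (d := d) a) (coercive_calDalev L M a ha (k + 1))
  have hid := one_add_mul_inv_eq hX' hY' (regionGW_eq_calDalev_sub L M (k + 1) m layer a a' ha)
  have hκ' := opNorm_inv_mul_EGW_le L M (k + 1) m layer a a' ha hγ hco' hE'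
  have h1 : 0 ≤ 1 + γ⁻¹ * e := by have := mul_nonneg (inv_nonneg.mpr hγ.le) he; linarith
  rw [← hid, Matrix.mul_assoc]
  calc ‖(1 + (regionGW L M (k + 1) m layer a a')⁻¹ * EGW L M (k + 1) m layer a a' ha)
          * ((calDalev L M a ha (k + 1))⁻¹ * (1 - JpcT L M k * (JpcT L M k)ᴴ))‖
      ≤ ‖1 + (regionGW L M (k + 1) m layer a a')⁻¹ * EGW L M (k + 1) m layer a a' ha‖
          * ‖(calDalev L M a ha (k + 1))⁻¹ * (1 - JpcT L M k * (JpcT L M k)ᴴ)‖ := Matrix.l2_opNorm_mul _ _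
    _ ≤ (1 + γ⁻¹ * e) * (2 * d * Cst d a * ((L : ℝ)⁻¹) ^ k) :=
        mul_le_mul (opNorm_one_add_le hκ') (complement_le_lev L M a ha k) (norm_nonneg _) h1

end OneLevel

/-! ## §3 The graded-well tower re-based at level `m`: the `U = 1` bundle -/

section Tower

variable {d : ℕ} (L : ℕ) [NeZero L] (M : Fin d → ℕ) [hM : ∀ μ, NeZero (M μ)] (m : ℕ) (layer : Tor M → ℕ) (a a' : ℝ) (ha : 0 < a)

/-- **`FreeTowerLaws` FOR THE GRADED-WELL TOWER RE-BASED AT LEVEL `m`** from EXACTLY the hypotheses of `hinjK_GW_of_torus`: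
invertibility from `hco`, King's `‖Qlev‖² ≤ L^{−d}`, `‖JpcT‖ ≤ 1`, exact pairing (`F = 0`), complement law §2, injected law = the torus
transfer. [folklore] -/
theorem freeTowerLaws_GW_of_torus {γ e θ Ce : ℝ} (hγ : 0 < γ) (he : 0 ≤ e) (hθ : (L : ℝ)⁻¹ ≤ θ)
    (hco : ∀ k, m ≤ k → Coercive (regionGW L M k m layer a a') γ)
    (hE : ∀ k, m ≤ k → ‖EGW L M k m layer a a' ha‖ ≤ e)
    (hEc : ∀ k, m ≤ k → ‖EGW L M (k + 1) m layer a a' ha * JpcT L M k - JpcT L M k * EGW L M k m layer a a' ha‖ ≤ Ce * θ ^ k) :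
    FreeTowerLaws (ι := fun k => idx L M (m + k)) (fun k => regionGW L M (m + k) m layer a a') (fun k => Qlev L M (m + k))
      (fun k => JpcT L M (m + k)) (fun _ => 0) ((L : ℝ) ^ d)
      (fun k => (1 + γ⁻¹ * e) * (2 * d * Cst d a * ((L : ℝ)⁻¹) ^ (m + k))) (fun k => C1T d a γ e Ce * θ ^ (m + k))
      (fun _ => 0) where
  isUnit_det := fun k => isUnit_det_of_coercive hγ (hco (m + k) (Nat.le_add_right m k))
  opNorm_A_sq_le := fun k => opNorm_Qlev_sq_le L M (m + k)
  opNorm_J_le := fun k => opNorm_JpcT_le L M (m + k)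
  A_mul_J := fun k => sqrt_smul_Qlev_mul_JpcT L M (m + k)
  opNorm_F_mul_inv_le := fun k => by rw [Matrix.zero_mul, norm_zero]
  opNorm_inv_mul_F_le := fun k => by rw [Matrix.conjTranspose_zero, Matrix.mul_zero, norm_zero]
  complement_le := fun k =>
    complement_le_GW L M (m + k) m layer a a' ha hγ he (hco (m + k + 1) (Nat.le_add_right_of_le (Nat.le_add_right m k)))
      (hE (m + k + 1) (Nat.le_add_right_of_le (Nat.le_add_right m k)))
  injected_le := fun k => hinjK_GW_of_torus L M m layer a a' ha hγ he hθ hco hE hEc (m + k) (Nat.le_add_right m k)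

/-! ## §4 (GW-A): the tower limit with rate, free and perturbed -/

/-- **(GW-A) THE GRADED-WELL TOWER CONVERGES** (`L⁻¹ ≤ θ < 1`; `γ`, `e`, (GW-E) displayed): the King-averaged images of the graded-well
propagators `(regionGW_{m+k})⁻¹` on the level-`m` lattice satisfy
`TowerLimitRate (k ↦ Qlev (m+k)) L^d (k ↦ G_GW(m+k)) (Cpert 0 ((1+γ⁻¹e)·2d·Cst·θ^m) (C1T·θ^m) 0 0 0) θ`, i.e. they converge with
`‖c_k − c_∞‖ ≤ (C1T + (1+γ⁻¹e)·2d·Cst)·θ^m·θ^k/(1 − θ)`. [cite: King1986, Lemma 4.5 (4.38) p.674 (shape)] [folklore] -/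
theorem towerLimitRate_GW_of_torus {γ e θ Ce : ℝ} (hγ : 0 < γ) (he : 0 ≤ e) (hθ : (L : ℝ)⁻¹ ≤ θ) (hθ1 : θ < 1)
    (hco : ∀ k, m ≤ k → Coercive (regionGW L M k m layer a a') γ)
    (hE : ∀ k, m ≤ k → ‖EGW L M k m layer a a' ha‖ ≤ e)
    (hEc : ∀ k, m ≤ k → ‖EGW L M (k + 1) m layer a a' ha * JpcT L M k - JpcT L M k * EGW L M k m layer a a' ha‖ ≤ Ce * θ ^ k) :
    TowerLimitRate (ι := fun k => idx L M (m + k)) (fun k => Qlev L M (m + k)) ((L : ℝ) ^ d)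
      (fun k => (regionGW L M (m + k) m layer a a')⁻¹)
      (Cpert 0 ((1 + γ⁻¹ * e) * (2 * d * Cst d a) * θ ^ m) (C1T d a γ e Ce * θ ^ m) 0 0 0) θ := by
  have hr : (0 : ℝ) < (L : ℝ) ^ d := pow_pos (by exact_mod_cast Nat.pos_of_ne_zero (NeZero.ne L)) d
  have hL0 : (0 : ℝ) ≤ (L : ℝ)⁻¹ := inv_nonneg.mpr (Nat.cast_nonneg L)
  have h1 : 0 ≤ 1 + γ⁻¹ * e := by have := mul_nonneg (inv_nonneg.mpr hγ.le) he; linarith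
  have hC₀ : 0 ≤ (1 + γ⁻¹ * e) * (2 * d * Cst d a) := mul_nonneg h1 (by have := Cst_nonneg d a; positivity)
  have ht : ‖(0 : ℂ)‖ * 0 < 1 := by rw [norm_zero, zero_mul]; exact one_pos
  have h₀ : ∀ k, (1 + γ⁻¹ * e) * (2 * d * Cst d a * ((L : ℝ)⁻¹) ^ (m + k))
      ≤ (1 + γ⁻¹ * e) * (2 * d * Cst d a) * θ ^ m * θ ^ k := fun k => by
    have hp : ((L : ℝ)⁻¹) ^ (m + k) ≤ θ ^ m * θ ^ k := by rw [← pow_add]; exact pow_le_pow_left₀ hL0 hθ (m + k)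
    calc (1 + γ⁻¹ * e) * (2 * d * Cst d a * ((L : ℝ)⁻¹) ^ (m + k))
        = (1 + γ⁻¹ * e) * (2 * d * Cst d a) * ((L : ℝ)⁻¹) ^ (m + k) := by ring
      _ ≤ (1 + γ⁻¹ * e) * (2 * d * Cst d a) * (θ ^ m * θ ^ k) := mul_le_mul_of_nonneg_left hp hC₀
      _ = (1 + γ⁻¹ * e) * (2 * d * Cst d a) * θ ^ m * θ ^ k := by ring
  have h₁ : ∀ k, C1T d a γ e Ce * θ ^ (m + k) ≤ C1T d a γ e Ce * θ ^ m * θ ^ k := fun k => by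
    rw [pow_add, mul_assoc]
  have h := towerLimitRate_perturbed hr (freeTowerLaws_GW_of_torus L M m layer a a' ha hγ he hθ hco hE hEc)
    (perturbationLaws_zero (D := fun k => regionGW L M (m + k) m layer a a') (J := fun k => JpcT L M (m + k))) hθ1
    h₀ h₁ (fun k => by rw [zero_mul]) (fun k => by rw [zero_mul]) ht
  simp only [zero_smul, add_zero] at h
  exact h

/-- **THE RESOLVENT ROUTE RUNS VERBATIM ON THE GRADED WELL**: for every perturbation family `P` on the re-based tower with
`PerturbationLaws (k ↦ regionGW_{m+k}) P (k ↦ JpcT (m+k)) κ (k ↦ C₂θ^k)` and every coupling `‖t‖κ < 1`, the perturbed graded-well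
covariances converge at rate `θ` (modulo the same three displayed inputs) — how tiers A/B re-run on `GW_m`. [folklore] -/
theorem towerLimitRate_GW_perturbed {γ e θ Ce : ℝ} (hγ : 0 < γ) (he : 0 ≤ e) (hθ : (L : ℝ)⁻¹ ≤ θ) (hθ1 : θ < 1)
    (hco : ∀ k, m ≤ k → Coercive (regionGW L M k m layer a a') γ)
    (hE : ∀ k, m ≤ k → ‖EGW L M k m layer a a' ha‖ ≤ e)
    (hEc : ∀ k, m ≤ k → ‖EGW L M (k + 1) m layer a a' ha * JpcT L M k - JpcT L M k * EGW L M k m layer a a' ha‖ ≤ Ce * θ ^ k)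
    {P : (k : ℕ) → Matrix (idx L M (m + k)) (idx L M (m + k)) ℂ} {κ C₂ : ℝ}
    (hpert : PerturbationLaws (ι := fun k => idx L M (m + k)) (fun k => regionGW L M (m + k) m layer a a') P
      (fun k => JpcT L M (m + k)) κ (fun k => C₂ * θ ^ k)) {t : ℂ} (ht : ‖t‖ * κ < 1) :
    TowerLimitRate (ι := fun k => idx L M (m + k)) (fun k => Qlev L M (m + k)) ((L : ℝ) ^ d)
      (fun k => (regionGW L M (m + k) m layer a a' + t • P k)⁻¹)
      (Cpert κ ((1 + γ⁻¹ * e) * (2 * d * Cst d a) * θ ^ m) (C1T d a γ e Ce * θ ^ m) C₂ 0 t) θ := by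
  have hr : (0 : ℝ) < (L : ℝ) ^ d := pow_pos (by exact_mod_cast Nat.pos_of_ne_zero (NeZero.ne L)) d
  have hL0 : (0 : ℝ) ≤ (L : ℝ)⁻¹ := inv_nonneg.mpr (Nat.cast_nonneg L)
  have h1 : 0 ≤ 1 + γ⁻¹ * e := by have := mul_nonneg (inv_nonneg.mpr hγ.le) he; linarith
  have hC₀ : 0 ≤ (1 + γ⁻¹ * e) * (2 * d * Cst d a) := mul_nonneg h1 (by have := Cst_nonneg d a; positivity)
  have h₀ : ∀ k, (1 + γ⁻¹ * e) * (2 * d * Cst d a * ((L : ℝ)⁻¹) ^ (m + k))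
      ≤ (1 + γ⁻¹ * e) * (2 * d * Cst d a) * θ ^ m * θ ^ k := fun k => by
    have hp : ((L : ℝ)⁻¹) ^ (m + k) ≤ θ ^ m * θ ^ k := by rw [← pow_add]; exact pow_le_pow_left₀ hL0 hθ (m + k)
    calc (1 + γ⁻¹ * e) * (2 * d * Cst d a * ((L : ℝ)⁻¹) ^ (m + k))
        = (1 + γ⁻¹ * e) * (2 * d * Cst d a) * ((L : ℝ)⁻¹) ^ (m + k) := by ring
      _ ≤ (1 + γ⁻¹ * e) * (2 * d * Cst d a) * (θ ^ m * θ ^ k) := mul_le_mul_of_nonneg_left hp hC₀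
      _ = (1 + γ⁻¹ * e) * (2 * d * Cst d a) * θ ^ m * θ ^ k := by ring
  have h₁ : ∀ k, C1T d a γ e Ce * θ ^ (m + k) ≤ C1T d a γ e Ce * θ ^ m * θ ^ k := fun k => by
    rw [pow_add, mul_assoc]
  exact towerLimitRate_perturbed hr (freeTowerLaws_GW_of_torus L M m layer a a' ha hγ he hθ hco hE hEc) hpert hθ1
    h₀ h₁ (fun k => le_rfl) (fun k => by rw [zero_mul]) ht

end Tower

end Summit.QuantumFields.BalabanUV.T4Continuum.GradedWellTowerAssembly

end
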